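import Literature.NumberTheory.GaloisRepresentations.QuadraticIdeleNormResidueExact
import Literature.NumberTheory.QuadraticForms.HasseNormTheoremHolds
import Literature.NumberTheory.Automorphic.QuadraticIdelicNormRange
import Literature.NumberTheory.GaloisRepresentations.QuadraticNormGroupNormCompat
import HarnessLib

/-!
# The quadratic Artin indicator `𝕀_K → ℤ∕2`, `X ↦ [X ∉ Kˣ · N(𝕀_{K(√d)})]`: a character of order two, its readings as a
# parity of non-norm places (O'Meara 71:19), as a product of Hilbert symbols, and as «global × idelic norm»

Topic `NumberTheory/GaloisRepresentations` (global class field theory, quadratic case); namespace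
`Literature.NumberTheory.GaloisRepresentations`.  ONE definition with body (`quadraticArtinIndicator`, DEF lane) + theorems; no
named fact, no instance, no notation, no `sorry`; net debt 0.

THE PRINT.  For a quadratic extension `E = K(√d)` of number fields the norm group `Kˣ · N_{E/K}(𝕀_E)` has index `2` in the idele group
`𝕀_K` (Cassels–Fröhlich VII §5.1 (B) with §6; O'Meara §65D Prop. 65:21, in the tree ★ `OMeara65.normIdeles_index_eq_two_holds` for the
componentwise group ★ `normIdeles K d` = the idèles that are local norms at every place, O'Meara §65A Example 65:2 = ★
`Automorphic.range_ideleRelNorm_eq_normIdeles`); the quotient character `𝕀_K → 𝕀_K ∕ Kˣ N(𝕀_E) ≅ ℤ∕2` is the (global, quadratic)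
ARTIN MAP — the «total norm-residue symbol» `X ↦ ∏_v (X_v, d)_v`, trivial exactly on `Kˣ N(𝕀_E)` (O'Meara §71 Thm. 71:19 with 71:18).

* §1 `quadraticArtinIndicator K d : ideleGroup K → ZMod 2` (the indicator of `X ∉ principalIdeles K ⊔ normIdeles K d`) and its algebra:
  `…_eq_zero_iff`, `…_eq_one_iff`, `…_of_mem_principalIdeles`, `…_of_mem_normIdeles`, `…_eq_zero_of_isSquare`, `…_inv`, and
  **`quadraticArtinIndicator_mul`** (additivity for `d ≠ 0`: the subgroup has index `≤ 2`).
* §3 **`quadraticArtinIndicator_ideleRelNorm`** — NORM FUNCTORIALITY along `K ⊆ L` of degree `≤ 3`: `[X]_{L,d} = [N_{L/K} X]_{K,d}`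
  (★ `QuadraticNormGroupNormCompat`, Neukirch VI (5.2) in the quadratic, low-degree case).
* §2 READINGS: **`quadraticArtinIndicator_eq_natCast_ncard`** — the indicator is the PARITY of the number of places (finite + infinite)
  at which `X` is not a local norm (★ R4 `mem_principalIdeles_sup_normIdeles_iff_even`); `…_eq_zero_iff_prod_hilbertSymbol_eq_one`
  (★ R4, Hilbert-symbol form); `…_ideleRelNorm_self_eq_zero`; **`quadraticArtinIndicator_eq_zero_iff_exists_ideleRelNorm`** — `= 0` iff `X = (k) · N_{E/K}(Z)` for a
  global `k ∈ Kˣ` and an idele `Z` of `E` (★ O'Meara 65:2 `range_ideleRelNorm_eq_normIdeles`).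

USE (cell hodgecm-mathlib, engine T1 row G6∕R6c; consumers `Rogawski1990/CartanObstruction` (R6d: `cartanObs γ₀ p := (indicator_j (X_j p))_j`),
`GaloisRepresentations/HasseNormEtaleInvolutionFactors` ((D3): per τ-stable factor, «indicator = 0 ⇒ X_j = (k) · N(Z)»), `CartanObsHasse` (R7)):
the obstruction `obs : 𝒞_𝐀(γ₀) → 𝔈(T∕F)` of [Rogawski1990, §3.3, Prop. 3.5.2] for the maximal tori of `U(3)` is, factor by factor, this
indicator of the Cartan idele.  HC_CM is proved only modulo the printed citations until rung 0 closes; this file is idelic class field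
theory of quadratic extensions and asserts nothing about unitary groups.

## References
* [CasselsFrohlichANT1967] Cassels–Fröhlich (eds.), *Algebraic Number Theory* (1967), Ch. VII (Tate) §5.1 (B), §6 (the norm index of a
  cyclic extension), Ch. II §16 (idèles).
* [Omeara1963] O. T. O'Meara, *Introduction to Quadratic Forms* (1963), §65A Example 65:2, §65D Prop. 65:21, §71 Thms. 71:18, 71:19.
* [Rogawski1990] J. D. Rogawski, *Automorphic Representations of Unitary Groups in Three Variables* (1990), §3.3 (the obstruction), §3.5
  Prop. 3.5.2, §5.4 p. 72.
-/

set_option autoImplicit false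

noncomputable section

open NumberField IsDedekindDomain
open scoped Classical

namespace Literature.NumberTheory.GaloisRepresentations

open Literature.NumberTheory.QuadraticForms

variable (K : Type) [Field K] [NumberField K]

/-! ## §1 The indicator and its algebra -/

/-- **The quadratic Artin indicator** of `K(√d)/K` on the ideles of `K`: `0` on the norm group `Kˣ · N(𝕀_{K(√d)})`
(★ `principalIdeles K ⊔ normIdeles K d`, the idèles which are a global element times a local norm at every place) and `1` off it — the
global Artin map of the quadratic extension read in `ℤ∕2` (the «total norm-residue symbol» `∏_v (X_v, d)_v`).  A plain function; it is
additive for `d ≠ 0` (`quadraticArtinIndicator_mul`). [cite: CasselsFrohlichANT1967, Ch. VII §5.1 (B), §6] [cite: Omeara1963, §71 Thm. 71:19] -/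
def quadraticArtinIndicator (d : K) (X : ideleGroup K) : ZMod 2 :=
  if X ∈ principalIdeles K ⊔ normIdeles K d then 0 else 1

variable {K}

/-- The indicator vanishes exactly on `Kˣ · N(𝕀_{K(√d)})`. [cite: Omeara1963, §71 Thm. 71:19] -/
theorem quadraticArtinIndicator_eq_zero_iff {d : K} {X : ideleGroup K} :
    quadraticArtinIndicator K d X = 0 ↔ X ∈ principalIdeles K ⊔ normIdeles K d := by
  unfold quadraticArtinIndicator
  split_ifs with h
  · simp [h]
  · simp only [h, iff_false]; decide

/-- The indicator is `1` exactly off `Kˣ · N(𝕀_{K(√d)})`. [cite: Omeara1963, §71 Thm. 71:19] -/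
theorem quadraticArtinIndicator_eq_one_iff {d : K} {X : ideleGroup K} :
    quadraticArtinIndicator K d X = 1 ↔ X ∉ principalIdeles K ⊔ normIdeles K d := by
  unfold quadraticArtinIndicator
  split_ifs with h
  · simp only [h, not_true_eq_false, iff_false]; decide
  · simp [h]

/-- The indicator takes only the values `0` and `1`. [folklore] -/
private theorem quadraticArtinIndicator_eq_zero_or_eq_one (d : K) (X : ideleGroup K) :
    quadraticArtinIndicator K d X = 0 ∨ quadraticArtinIndicator K d X = 1 := by
  unfold quadraticArtinIndicator
  split_ifs <;> simp

/-- Principal idèles (global elements) have indicator `0`. [cite: CasselsFrohlichANT1967, Ch. VII §5.1 (B)] -/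
theorem quadraticArtinIndicator_of_mem_principalIdeles {d : K} {X : ideleGroup K} (hX : X ∈ principalIdeles K) :
    quadraticArtinIndicator K d X = 0 :=
  quadraticArtinIndicator_eq_zero_iff.2 (Subgroup.mem_sup_left hX)

/-- Norm idèles (local norms at every place) have indicator `0`. [cite: Omeara1963, §65A Example 65:2] -/
theorem quadraticArtinIndicator_of_mem_normIdeles {d : K} {X : ideleGroup K} (hX : X ∈ normIdeles K d) :
    quadraticArtinIndicator K d X = 0 :=
  quadraticArtinIndicator_eq_zero_iff.2 (Subgroup.mem_sup_right hX)

/-- For `d` a non-zero SQUARE (`K(√d) = K`) the indicator is identically `0`. [cite: Omeara1963, §65A Example 65:2] -/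
theorem quadraticArtinIndicator_eq_zero_of_isSquare {d : K} (hd : IsSquare d) (hd0 : d ≠ 0) (X : ideleGroup K) :
    quadraticArtinIndicator K d X = 0 := by
  apply quadraticArtinIndicator_of_mem_normIdeles
  rw [normIdeles_eq_top_of_isSquare K hd hd0]
  exact Subgroup.mem_top X

/-- The indicator is symmetric under inversion (the norm group is a subgroup). [cite: CasselsFrohlichANT1967, Ch. VII §5.1 (B)] -/
theorem quadraticArtinIndicator_inv (d : K) (X : ideleGroup K) :
    quadraticArtinIndicator K d X⁻¹ = quadraticArtinIndicator K d X := by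
  unfold quadraticArtinIndicator
  rw [Subgroup.inv_mem_iff]

/-- In a subgroup of index `2`, the product of two non-members is a member. [folklore] -/
private theorem mul_mem_of_not_mem_of_index_eq_two {G : Type*} [CommGroup G] {H : Subgroup G} (hH : H.index = 2) {x y : G}
    (hx : x ∉ H) (hy : y ∉ H) : x * y ∈ H := by
  obtain ⟨a, ha⟩ := Subgroup.index_eq_two_iff.1 hH
  by_contra hxy
  have hxa : x * a ∈ H := (ha x).or.resolve_right hx
  have hxya : x * y * a ∈ H := (ha (x * y)).or.resolve_right hxy
  rw [mul_comm x y, mul_assoc] at hxya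
  exact hy ((Subgroup.mul_mem_cancel_right H hxa).1 hxya)

/-- **Additivity**: for `d ≠ 0` the indicator is a character, `[XY] = [X] + [Y]` in `ℤ∕2` — the norm group has index `2` for `d ∉ K²`
(★ O'Meara 65:21 `normIdeles_index_eq_two_holds`) and is everything for `d ∈ K²`. [cite: Omeara1963, §65D Prop. 65:21]
[cite: CasselsFrohlichANT1967, Ch. VII §5.1 (B), §6] -/
theorem quadraticArtinIndicator_mul {d : K} (hd0 : d ≠ 0) (X Y : ideleGroup K) :
    quadraticArtinIndicator K d (X * Y) = quadraticArtinIndicator K d X + quadraticArtinIndicator K d Y := by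
  by_cases hsq : IsSquare d
  · simp [quadraticArtinIndicator_eq_zero_of_isSquare hsq hd0]
  have hidx : (principalIdeles K ⊔ normIdeles K d).index = 2 := OMeara65.normIdeles_index_eq_two_holds K d hsq
  set H := principalIdeles K ⊔ normIdeles K d with hH
  unfold quadraticArtinIndicator
  rw [← hH]
  by_cases hX : X ∈ H <;> by_cases hY : Y ∈ H
  · simp [hX, hY, H.mul_mem hX hY]
  · have : X * Y ∉ H := fun h => hY (by simpa using H.mul_mem (H.inv_mem hX) h)
    simp [hX, hY, this]
  · have : X * Y ∉ H := fun h => hX (by simpa using H.mul_mem h (H.inv_mem hY))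
    simp [hX, hY, this]
  · have : X * Y ∈ H := mul_mem_of_not_mem_of_index_eq_two hidx hX hY
    simp only [hX, hY, this, if_true, if_false]
    decide

/-! ## §2 Readings: parity of non-norm places, Hilbert symbols, global × idelic norm -/

/-- **The indicator is the parity of the number of non-norm places** (finite and infinite): for `d ∉ K²`,
`[X] = #{v : X_v ∉ N(K_v(√d)ˣ)} + #{w : X_w ∉ N(K_w(√d)ˣ)} (mod 2)` — the quadratic Artin map as the sum of the local
norm-residue symbols (★ R4 `mem_principalIdeles_sup_normIdeles_iff_even`). [cite: Omeara1963, §71 Thm. 71:19] -/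
theorem quadraticArtinIndicator_eq_natCast_ncard {d : K} (hd : ¬ IsSquare d) (X : ideleGroup K) :
    quadraticArtinIndicator K d X =
      (({v : HeightOneSpectrum (𝓞 K) | ideleFiniteComponent K v X ∉
            quadraticNormSubgroup (v.adicCompletion K) (algebraMap K (v.adicCompletion K) d)}.ncard +
        {w : InfinitePlace K | ideleInfiniteComponent K w X ∉
            quadraticNormSubgroup w.Completion (algebraMap K w.Completion d)}.ncard : ℕ) : ZMod 2) := by
  have hiff := (quadraticArtinIndicator_eq_zero_iff (d := d) (X := X)).trans
    ((mem_principalIdeles_sup_normIdeles_iff_even hd X).trans (ZMod.natCast_eq_zero_iff_even).symm)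
  rcases quadraticArtinIndicator_eq_zero_or_eq_one d X with h | h
  · rw [h]; exact (hiff.1 h).symm
  · rw [h]
    have hne : ((_ : ℕ) : ZMod 2) ≠ 0 := fun h0 => by rw [hiff.2 h0] at h; exact zero_ne_one h
    revert hne
    generalize ((_ : ℕ) : ZMod 2) = z
    decide +revert

/-- **The indicator as the total Hilbert symbol**: for `d ∉ K²` and any finite set `S` of finite places outside which `X` is a local norm,
`[X] = 0 ⟺ (∏_{v ∈ S} (X_v, d)_v) · ∏_{w ∣ ∞} (X_w, d)_w = 1` (★ R4). [cite: Omeara1963, §71 Thms. 71:18, 71:19] -/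
theorem quadraticArtinIndicator_eq_zero_iff_prod_hilbertSymbol_eq_one {d : K} (hd : ¬ IsSquare d) (X : ideleGroup K)
    (S : Finset (HeightOneSpectrum (𝓞 K)))
    (hS : ∀ v ∉ S, ideleFiniteComponent K v X ∈ quadraticNormSubgroup (v.adicCompletion K) (algebraMap K (v.adicCompletion K) d)) :
    quadraticArtinIndicator K d X = 0 ↔
      (∏ v ∈ S, hilbertSymbol (v.adicCompletion K) (ideleFiniteComponent K v X : v.adicCompletion K)
          (algebraMap K (v.adicCompletion K) d)) *
        ∏ w : InfinitePlace K, hilbertSymbol w.Completion (ideleInfiniteComponent K w X : w.Completion)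
          (algebraMap K w.Completion d) = 1 :=
  quadraticArtinIndicator_eq_zero_iff.trans (mem_principalIdeles_sup_normIdeles_iff_prod_hilbertSymbol_eq_one hd X S hS)

/-- **`[X] = 0 ⟺ X = (k) · N_{E/K}(Z)`** for a global `k ∈ Kˣ` and an idele `Z` of `E = K(√d)` (presented by `σ ∈ Aut(E/K)`, `δ ∈ E` with
`σ δ = −δ ≠ 0`, `δ² = d`): O'Meara's Example 65:2 «an idèle is a norm from `𝕀_E` iff it is a local norm at every place»
(★ `Automorphic.range_ideleRelNorm_eq_normIdeles`). [cite: Omeara1963, §65A Example 65:2] [cite: CasselsFrohlichANT1967, Ch. VII §5.1 (B)] -/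
theorem quadraticArtinIndicator_eq_zero_iff_exists_ideleRelNorm {E : Type} [Field E] [NumberField E] [Algebra K E]
    [IsGalois K E] [Algebra.IsQuadraticExtension K E] (σ : E ≃ₐ[K] E) {δ : E} (hσδ : σ δ = -δ) (hδ : δ ≠ 0) {d : K} (hd : δ * δ = algebraMap K E d) (X : ideleGroup K) :
    quadraticArtinIndicator K d X = 0 ↔
      ∃ (k : Kˣ) (Z : ideleGroup E), X = Units.map (algebraMap K (AdeleRing (𝓞 K) K)).toMonoidHom k *
        Literature.NumberTheory.Automorphic.AdeleRing.ideleRelNorm K E Z := by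
  rw [quadraticArtinIndicator_eq_zero_iff, ← Literature.NumberTheory.Automorphic.range_ideleRelNorm_eq_normIdeles σ hσδ hδ hd,
    Subgroup.mem_sup]
  constructor
  · rintro ⟨p, ⟨k, rfl⟩, n, ⟨Z, rfl⟩, h⟩
    exact ⟨k, Z, h.symm⟩
  · rintro ⟨k, Z, h⟩
    exact ⟨_, ⟨k, rfl⟩, _, ⟨Z, rfl⟩, h.symm⟩


/-- **Norms from `E = K(√d)` itself have indicator `0`**: `[N_{E/K} Z]_{K, d} = 0` for every idele `Z` of `E` (O'Meara 65:2: idelic norms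
are local norms everywhere).  With `quadraticArtinIndicator_mul` and `_ideleRelNorm` this is the vanishing `∑_j [N_{K₀,j/F} X_j] =
[N_{E/F}(det g)] = 0` that puts an obstruction vector in the sum-zero hyperplane. [cite: Omeara1963, §65A Example 65:2] -/
theorem quadraticArtinIndicator_ideleRelNorm_self_eq_zero {E : Type} [Field E] [NumberField E] [Algebra K E]
    [IsGalois K E] [Algebra.IsQuadraticExtension K E] (σ : E ≃ₐ[K] E) {δ : E} (hσδ : σ δ = -δ) (hδ : δ ≠ 0) {d : K}
    (hd : δ * δ = algebraMap K E d) (Z : ideleGroup E) :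
    quadraticArtinIndicator K d (Literature.NumberTheory.Automorphic.AdeleRing.ideleRelNorm K E Z) = 0 :=
  (quadraticArtinIndicator_eq_zero_iff_exists_ideleRelNorm σ hσδ hδ hd _).2 ⟨1, Z, by simp⟩

/-! ## §3 Norm functoriality along an extension of degree `≤ 3` -/

/-- **NORM FUNCTORIALITY of the quadratic Artin indicator**: for `K ⊆ L` number fields with `[L : K] ≤ 3`, `d ∈ Kˣ` and an idele `X` of
`L`, `[X]_{L, d} = [N_{L/K} X]_{K, d}` (`N_{L/K}` = FLT packet ★ `AdelicBaseChange.ideleRelNorm`) — the norm-compatibility of the Artin map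
of `K(√d)/K` along `L/K` (★ `mem_principalIdeles_sup_normIdeles_iff_ideleRelNorm_mem`). [cite: NeukirchANT1999, Ch. VI (5.2)]
[cite: CasselsFrohlichANT1967, Ch. VII §5.1 (B), §6] -/
theorem quadraticArtinIndicator_ideleRelNorm {L : Type} [Field L] [NumberField L] [Algebra K L] (hKL : Module.finrank K L ≤ 3)
    {d : K} (hd0 : d ≠ 0) (X : ideleGroup L) :
    quadraticArtinIndicator L (algebraMap K L d) X =
      quadraticArtinIndicator K d (Literature.NumberTheory.AdelicBaseChange.ideleRelNorm K L X) := by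
  have hiff := (quadraticArtinIndicator_eq_zero_iff (d := algebraMap K L d) (X := X)).trans
    ((mem_principalIdeles_sup_normIdeles_iff_ideleRelNorm_mem K L hKL hd0 X).trans quadraticArtinIndicator_eq_zero_iff.symm)
  rcases quadraticArtinIndicator_eq_zero_or_eq_one (algebraMap K L d) X with h | h
  · rw [h, eq_comm]; exact hiff.1 h
  · rcases quadraticArtinIndicator_eq_zero_or_eq_one d (Literature.NumberTheory.AdelicBaseChange.ideleRelNorm K L X) with h' | h'
    · exact absurd (hiff.2 h') (by rw [h]; exact one_ne_zero)
    · rw [h, h']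

end Literature.NumberTheory.GaloisRepresentations

end
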